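import Mathlib.Analysis.InnerProductSpace.Basic
import Mathlib.Algebra.BigOperators.Ring.Finset
import Mathlib.Data.Finset.SymmDiff

/-!
# No centred tight-frame two-distance configurations with a non-even "exclusive-neighbour count" (ghosts of the three-point bound)

Framing: lottery ticket; floor = certified bounds/negative ranges. Venture `PackingBounds` (cell
`pub-packcert`, recognition seat, T5.md §5/§8/§9).

Generalisation of `GhostTwentySeven.no_ghost_config_27`. Let `C` be a finite set of `N` unit vectors
in a real inner product space with (i) inner products of distinct members in `{a, b}`, `a ≠ b`,
(ii) `Σ_{x∈C} ⟨x, y⟩ = 0` for every member `y` (centred) and (iii) `Σ_{x∈C} ⟨x, v⟩² = c‖v‖²` for all `v`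
(tight frame). Then every member has the same number `k` of `a`-neighbours (`1 + k a + (N-1-k) b = 0`),
and if `1 + (N-1) b ≠ 0` (so `k ≥ 1`) two `a`-neighbours `y, z` exist; the frame identity at `v = y - z`
reads `c (2 - 2a) = 2 (1 - a)² + (a - b)² · q` where `q` is the number of members that are an
`a`-neighbour of exactly one of `y, z` — an EVEN number (`q = (k-1) + (k-1) - 2p`). Hence such a
configuration cannot exist when `(c(2 - 2a) - 2(1 - a)²)/(a - b)²` is not an even natural number
(`no_twoDistance_tightFrame_config`). Instances (the five SDP-level ghost cells of T5.md §8, where the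
Bachoc–Vallentin bound is EXACTLY the integer `N` and complementary slackness forces (i)–(iii)):
`(112, 1/15, -1/3, 56/15)` (q = 98/3) — the `(27, 1/10, -1/2, 27/10)` case (q = 9) is
`GhostTwentySeven.no_ghost_config_27`, already in the tree —
`(100, 1/21, -1/3, 20/7)` (q = 25), `(121, 1/56, -3/8, 121/56)` (q = 15), `(156, 1/40, -3/10, 39/16)`
(q = 27).

What is NOT here: the certificates and the derivation of (i)–(iii) from them (see `ThreePointTight`).
-/

open Finset
open scoped RealInnerProductSpace BigOperators

namespace Summit.Ventures.PackingBounds.SphericalCodes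

variable {E : Type*} [NormedAddCommGroup E] [InnerProductSpace ℝ E] [DecidableEq E]

/-- Valency from centredness: in a finite set of unit vectors with inner products of distinct members in
`{a, b}`, a member `y` with `Σ_{x∈C} ⟨x, y⟩ = 0` has exactly `k` `a`-neighbours where
`(a - b) k = -(1 + (|C| - 1) b)`. -/
theorem twoDistance_valency (C : Finset E) (a b : ℝ)
    (hval : ∀ x ∈ C, ∀ y ∈ C, x ≠ y → inner ℝ x y = a ∨ inner ℝ x y = b)
    (hC : ∀ x ∈ C, ‖x‖ = 1) (y : E) (hy : y ∈ C) (hcent : ∑ x ∈ C, inner ℝ x y = 0) :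
    (a - b) * (((C.erase y).filter (fun x => inner ℝ x y = a)).card : ℝ)
      = -(1 + ((C.card : ℝ) - 1) * b) := by
  classical
  set A := (C.erase y).filter (fun x => inner ℝ x y = a) with hA
  set B := (C.erase y).filter (fun x => ¬ inner ℝ x y = a) with hB
  have hself : inner ℝ y y = (1 : ℝ) := by
    rw [real_inner_self_eq_norm_sq, hC y hy]; norm_num
  have hsplit : ∑ x ∈ C, inner ℝ x y = 1 + ∑ x ∈ C.erase y, inner ℝ x y := by
    rw [← Finset.add_sum_erase C _ hy, hself]
  have hAB : ∑ x ∈ C.erase y, inner ℝ x y = ∑ x ∈ A, inner ℝ x y + ∑ x ∈ B, inner ℝ x y := by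
    rw [hA, hB, ← Finset.sum_filter_add_sum_filter_not (C.erase y) (fun x => inner ℝ x y = a)]
  have hAsum : ∑ x ∈ A, inner ℝ x y = (A.card : ℝ) * a := by
    rw [Finset.sum_congr rfl (fun x hx => (Finset.mem_filter.1 hx).2), Finset.sum_const, nsmul_eq_mul]
  have hBval : ∀ x ∈ B, inner ℝ x y = b := by
    intro x hx
    obtain ⟨hxE, hne⟩ := Finset.mem_filter.1 hx
    rcases hval x (Finset.mem_of_mem_erase hxE) y hy (Finset.ne_of_mem_erase hxE) with h | h
    · exact absurd h hne
    · exact h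
  have hBsum : ∑ x ∈ B, inner ℝ x y = (B.card : ℝ) * b := by
    rw [Finset.sum_congr rfl hBval, Finset.sum_const, nsmul_eq_mul]
  have hcardAB : A.card + B.card = C.card - 1 := by
    rw [hA, hB, Finset.card_filter_add_card_filter_not, Finset.card_erase_of_mem hy]
  have hpos : 1 ≤ C.card := Finset.card_pos.2 ⟨y, hy⟩
  have hABr : (A.card : ℝ) + (B.card : ℝ) = (C.card : ℝ) - 1 := by
    have : ((A.card + B.card : ℕ) : ℝ) = ((C.card - 1 : ℕ) : ℝ) := by rw [hcardAB]
    push_cast [Nat.cast_sub hpos] at this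
    linarith
  rw [hsplit, hAB, hAsum, hBsum] at hcent
  have hBr : (B.card : ℝ) = (C.card : ℝ) - 1 - (A.card : ℝ) := by linarith
  rw [hBr] at hcent
  linarith

/-- **No two-distance tight-frame ghost.** A finite set `C` of unit vectors in a real inner product
space with inner products of distinct members in `{a, b}` (`a ≠ b`), centred (`Σ_x ⟨x, y⟩ = 0` for every
member `y`), tight (`Σ_x ⟨x, v⟩² = c‖v‖²` for all `v`) and with `1 + (|C|-1) b ≠ 0` forces
`c(2 - 2a) - 2(1 - a)² = (a - b)² · q` for an EVEN natural number `q` (the number of members that are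
`a`-neighbours of exactly one of two fixed `a`-neighbours `y, z`). So if no even natural number `q`
satisfies this, no such `C` exists. -/
theorem no_twoDistance_tightFrame_config (C : Finset E) (a b c : ℝ) (hab : a ≠ b)
    (hC : ∀ x ∈ C, ‖x‖ = 1)
    (hval : ∀ x ∈ C, ∀ y ∈ C, x ≠ y → inner ℝ x y = a ∨ inner ℝ x y = b)
    (hcent : ∀ y ∈ C, ∑ x ∈ C, inner ℝ x y = 0)
    (hframe : ∀ v : E, ∑ x ∈ C, (inner ℝ x v) ^ 2 = c * ‖v‖ ^ 2)
    (hb : 1 + ((C.card : ℝ) - 1) * b ≠ 0) (hne : C.Nonempty)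
    (hq : ∀ m : ℕ, (a - b) ^ 2 * (2 * (m : ℝ)) ≠ c * (2 - 2 * a) - 2 * (1 - a) ^ 2) : False := by
  classical
  obtain ⟨y, hy⟩ := hne
  set Ny := (C.erase y).filter (fun x => inner ℝ x y = a) with hNy
  have hky := twoDistance_valency C a b hval hC y hy (hcent y hy)
  -- Ny is nonempty (else 1 + (N-1) b = 0)
  have hNyne : Ny.Nonempty := by
    rw [← Finset.card_pos]
    by_contra h0
    have h0' : Ny.card = 0 := by omega
    rw [h0'] at hky; simp at hky
    exact hb (by linarith)
  obtain ⟨z, hz⟩ := hNyne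
  obtain ⟨hzE, hzy⟩ := Finset.mem_filter.1 hz
  have hzC : z ∈ C := Finset.mem_of_mem_erase hzE
  have hzney : z ≠ y := Finset.ne_of_mem_erase hzE
  have hyz : inner ℝ y z = a := by rw [real_inner_comm]; exact hzy
  set Nz := (C.erase z).filter (fun x => inner ℝ x z = a) with hNz
  have hkz := twoDistance_valency C a b hval hC z hzC (hcent z hzC)
  have hkeq : (Ny.card : ℝ) = (Nz.card : ℝ) := by
    have : (a - b) * (Ny.card : ℝ) = (a - b) * (Nz.card : ℝ) := by rw [hky, hkz]
    exact mul_left_cancel₀ (sub_ne_zero.2 hab) this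
  have hkeqN : Ny.card = Nz.card := by exact_mod_cast hkeq
  have hselfy : inner ℝ y y = (1 : ℝ) := by rw [real_inner_self_eq_norm_sq, hC y hy]; norm_num
  have hselfz : inner ℝ z z = (1 : ℝ) := by rw [real_inner_self_eq_norm_sq, hC z hzC]; norm_num
  -- the rest R = C \ {y, z}
  set R := (C.erase y).erase z with hR
  have hzR' : z ∈ C.erase y := hzE
  set Ay := R.filter (fun x => inner ℝ x y = a) with hAy
  set Az := R.filter (fun x => inner ℝ x z = a) with hAz
  have hAycard : Ay.card + 1 = Ny.card := by
    have hNy_eq : Ny = insert z Ay := by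
      ext x
      simp only [hNy, hAy, hR, Finset.mem_filter, Finset.mem_insert, Finset.mem_erase]
      constructor
      · rintro ⟨⟨hxy, hxC⟩, hx⟩
        by_cases hxz : x = z
        · exact Or.inl hxz
        · exact Or.inr ⟨⟨hxz, hxy, hxC⟩, hx⟩
      · rintro (rfl | ⟨⟨hxz, hxy, hxC⟩, hx⟩)
        · exact ⟨⟨hzney, hzC⟩, hzy⟩
        · exact ⟨⟨hxy, hxC⟩, hx⟩
    have hzAy : z ∉ Ay := by simp [hAy, hR]
    rw [hNy_eq, Finset.card_insert_of_notMem hzAy]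
  have hAzcard : Az.card + 1 = Nz.card := by
    have hNz_eq : Nz = insert y Az := by
      ext x
      simp only [hNz, hAz, hR, Finset.mem_filter, Finset.mem_insert, Finset.mem_erase]
      constructor
      · rintro ⟨⟨hxz, hxC⟩, hx⟩
        by_cases hxy : x = y
        · exact Or.inl hxy
        · exact Or.inr ⟨⟨hxz, hxy, hxC⟩, hx⟩
      · rintro (rfl | ⟨⟨hxz, hxy, hxC⟩, hx⟩)
        · exact ⟨⟨hzney.symm, hy⟩, hyz⟩
        · exact ⟨⟨hxz, hxC⟩, hx⟩
    have hyAz : y ∉ Az := by simp [hAz, hR]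
    rw [hNz_eq, Finset.card_insert_of_notMem hyAz]
  have hAyAz : Ay.card = Az.card := by omega
  -- on R, (⟨x,y⟩ - ⟨x,z⟩)² is (a-b)² on Ay ∆ Az and 0 elsewhere
  have hab2 : (b - a) ^ 2 = (a - b) ^ 2 := by ring
  have hRval : ∀ x ∈ R, (inner ℝ x y - inner ℝ x z) ^ 2
      = if x ∈ symmDiff Ay Az then (a - b) ^ 2 else 0 := by
    intro x hx
    have hxEy : x ∈ C.erase y := Finset.mem_of_mem_erase hx
    have hxC : x ∈ C := Finset.mem_of_mem_erase hxEy
    have hxz : x ≠ z := Finset.ne_of_mem_erase hx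
    have hxy : x ≠ y := Finset.ne_of_mem_erase hxEy
    have hmemAy : x ∈ Ay ↔ inner ℝ x y = a := by simp [hAy, hx]
    have hmemAz : x ∈ Az ↔ inner ℝ x z = a := by simp [hAz, hx]
    have hba : b ≠ a := fun h => hab h.symm
    rcases hval x hxC y hy hxy with h1 | h1 <;> rcases hval x hxC z hzC hxz with h2 | h2
    · have : x ∉ symmDiff Ay Az := by
        intro h
        rcases Finset.mem_symmDiff.1 h with ⟨_, hb'⟩ | ⟨_, hb'⟩
        · exact hb' (hmemAz.2 h2)
        · exact hb' (hmemAy.2 h1)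
      rw [if_neg this, h1, h2]; ring
    · have : x ∈ symmDiff Ay Az := by
        rw [Finset.mem_symmDiff]; left
        exact ⟨hmemAy.2 h1, fun h => hba (by rw [hmemAz] at h; rw [h] at h2; exact h2.symm)⟩
      rw [if_pos this, h1, h2]
    · have : x ∈ symmDiff Ay Az := by
        rw [Finset.mem_symmDiff]; right
        exact ⟨hmemAz.2 h2, fun h => hba (by rw [hmemAy] at h; rw [h] at h1; exact h1.symm)⟩
      rw [if_pos this, h1, h2, hab2]
    · have : x ∉ symmDiff Ay Az := by
        intro h
        rcases Finset.mem_symmDiff.1 h with ⟨ha, _⟩ | ⟨ha, _⟩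
        · exact hba (by rw [hmemAy] at ha; rw [ha] at h1; exact h1.symm)
        · exact hba (by rw [hmemAz] at ha; rw [ha] at h2; exact h2.symm)
      rw [if_neg this, h1, h2]; ring
  -- frame identity at v = y - z
  have hF := hframe (y - z)
  have hnorm : ‖y - z‖ ^ 2 = 2 - 2 * a := by
    rw [← real_inner_self_eq_norm_sq]
    simp only [inner_sub_left, inner_sub_right, hselfy, hselfz, hyz, hzy]
    ring
  have hsplit : ∑ x ∈ C, (inner ℝ x (y - z)) ^ 2
      = (1 - a) ^ 2 + (1 - a) ^ 2 + ∑ x ∈ R, (inner ℝ x y - inner ℝ x z) ^ 2 := by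
    rw [← Finset.add_sum_erase C _ hy, ← Finset.add_sum_erase (C.erase y) _ hzR']
    have e1 : (inner ℝ y (y - z)) ^ 2 = (1 - a) ^ 2 := by rw [inner_sub_right, hselfy, hyz]
    have e2 : (inner ℝ z (y - z)) ^ 2 = (1 - a) ^ 2 := by rw [inner_sub_right, hselfz, hzy]; ring
    rw [e1, e2, ← add_assoc]
    congr 1
    refine Finset.sum_congr rfl fun x _ => ?_
    rw [inner_sub_right]
  have hRsum : ∑ x ∈ R, (inner ℝ x y - inner ℝ x z) ^ 2
      = (a - b) ^ 2 * ((symmDiff Ay Az).card : ℝ) := by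
    have hsub : symmDiff Ay Az ⊆ R := by
      intro x hx
      rcases Finset.mem_symmDiff.1 hx with ⟨ha, _⟩ | ⟨ha, _⟩
      · exact (Finset.mem_filter.1 ha).1
      · exact (Finset.mem_filter.1 ha).1
    rw [Finset.sum_congr rfl hRval, Finset.sum_ite_mem, Finset.inter_eq_right.2 hsub,
      Finset.sum_const, nsmul_eq_mul, mul_comm]
  -- parity: |Ay ∆ Az| + 2 |Ay ∩ Az| = |Ay| + |Az| = 2 |Ay|
  have hpar : (symmDiff Ay Az).card + 2 * (Ay ∩ Az).card = Ay.card + Az.card := by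
    have h1 : symmDiff Ay Az = (Ay \ Az) ∪ (Az \ Ay) := Finset.symmDiff_def Ay Az
    have hdisj : Disjoint (Ay \ Az) (Az \ Ay) := disjoint_sdiff_sdiff
    have hc : (symmDiff Ay Az).card = (Ay \ Az).card + (Az \ Ay).card := by
      rw [h1, Finset.card_union_of_disjoint hdisj]
    have h2 := Finset.card_sdiff_add_card_inter Ay Az
    have h3 := Finset.card_sdiff_add_card_inter Az Ay
    rw [Finset.inter_comm Az Ay] at h3
    omega
  have hle : (Ay ∩ Az).card ≤ Ay.card := Finset.card_le_card Finset.inter_subset_left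
  obtain ⟨m, hm⟩ : ∃ m : ℕ, (symmDiff Ay Az).card = 2 * m :=
    ⟨Ay.card - (Ay ∩ Az).card, by omega⟩
  -- conclude
  have key : (a - b) ^ 2 * (2 * (m : ℝ)) = c * (2 - 2 * a) - 2 * (1 - a) ^ 2 := by
    have h := hF
    rw [hsplit, hRsum, hnorm, hm] at h
    push_cast at h
    linarith
  exact hq m key

/-- The (30, 1/15) ghost (N = 112, b = −1/3, c = 56/15; q would be 98/3): no such configuration. -/
theorem no_ghost_config_30_fifteenth (C : Finset E) (hcard : C.card = 112) (hC : ∀ x ∈ C, ‖x‖ = 1)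
    (hval : ∀ x ∈ C, ∀ y ∈ C, x ≠ y → inner ℝ x y = (1 / 15 : ℝ) ∨ inner ℝ x y = (-1 / 3 : ℝ))
    (hcent : ∀ y ∈ C, ∑ x ∈ C, inner ℝ x y = 0)
    (hframe : ∀ v : E, ∑ x ∈ C, (inner ℝ x v) ^ 2 = (56 / 15 : ℝ) * ‖v‖ ^ 2) : False := by
  refine no_twoDistance_tightFrame_config C (1 / 15) (-1 / 3) (56 / 15) (by norm_num) hC hval hcent hframe
    (by rw [hcard]; norm_num) (by rw [← Finset.card_pos, hcard]; norm_num) ?_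
  intro m h
  have h2 : (6 * m : ℝ) = 98 := by nlinarith [h]
  have h3 : (6 * m : ℕ) = 98 := by exact_mod_cast h2
  omega

/-- The (35, 1/21) ghost (N = 100, b = −1/3, c = 20/7; q would be 25): no such configuration. -/
theorem no_ghost_config_35_twentyfirst (C : Finset E) (hcard : C.card = 100) (hC : ∀ x ∈ C, ‖x‖ = 1)
    (hval : ∀ x ∈ C, ∀ y ∈ C, x ≠ y → inner ℝ x y = (1 / 21 : ℝ) ∨ inner ℝ x y = (-1 / 3 : ℝ))
    (hcent : ∀ y ∈ C, ∑ x ∈ C, inner ℝ x y = 0)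
    (hframe : ∀ v : E, ∑ x ∈ C, (inner ℝ x v) ^ 2 = (20 / 7 : ℝ) * ‖v‖ ^ 2) : False := by
  refine no_twoDistance_tightFrame_config C (1 / 21) (-1 / 3) (20 / 7) (by norm_num) hC hval hcent hframe
    (by rw [hcard]; norm_num) (by rw [← Finset.card_pos, hcard]; norm_num) ?_
  intro m h
  have h2 : (2 * m : ℝ) = 25 := by nlinarith [h]
  have h3 : (2 * m : ℕ) = 25 := by exact_mod_cast h2
  omega

/-- The (56, 1/56) ghost (N = 121, b = −3/8, c = 121/56; q would be 15): no such configuration. -/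
theorem no_ghost_config_56_fiftysixth (C : Finset E) (hcard : C.card = 121) (hC : ∀ x ∈ C, ‖x‖ = 1)
    (hval : ∀ x ∈ C, ∀ y ∈ C, x ≠ y → inner ℝ x y = (1 / 56 : ℝ) ∨ inner ℝ x y = (-3 / 8 : ℝ))
    (hcent : ∀ y ∈ C, ∑ x ∈ C, inner ℝ x y = 0)
    (hframe : ∀ v : E, ∑ x ∈ C, (inner ℝ x v) ^ 2 = (121 / 56 : ℝ) * ‖v‖ ^ 2) : False := by
  refine no_twoDistance_tightFrame_config C (1 / 56) (-3 / 8) (121 / 56) (by norm_num) hC hval hcent hframe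
    (by rw [hcard]; norm_num) (by rw [← Finset.card_pos, hcard]; norm_num) ?_
  intro m h
  have h2 : (2 * m : ℝ) = 15 := by nlinarith [h]
  have h3 : (2 * m : ℕ) = 15 := by exact_mod_cast h2
  omega

/-- The (64, 1/40) ghost (N = 156, b = −3/10, c = 39/16; q would be 27): no such configuration. -/
theorem no_ghost_config_64_fortieth (C : Finset E) (hcard : C.card = 156) (hC : ∀ x ∈ C, ‖x‖ = 1)
    (hval : ∀ x ∈ C, ∀ y ∈ C, x ≠ y → inner ℝ x y = (1 / 40 : ℝ) ∨ inner ℝ x y = (-3 / 10 : ℝ))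
    (hcent : ∀ y ∈ C, ∑ x ∈ C, inner ℝ x y = 0)
    (hframe : ∀ v : E, ∑ x ∈ C, (inner ℝ x v) ^ 2 = (39 / 16 : ℝ) * ‖v‖ ^ 2) : False := by
  refine no_twoDistance_tightFrame_config C (1 / 40) (-3 / 10) (39 / 16) (by norm_num) hC hval hcent hframe
    (by rw [hcard]; norm_num) (by rw [← Finset.card_pos, hcard]; norm_num) ?_
  intro m h
  have h2 : (2 * m : ℝ) = 27 := by nlinarith [h]
  have h3 : (2 * m : ℕ) = 27 := by exact_mod_cast h2
  omega

end Summit.Ventures.PackingBounds.SphericalCodes
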